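import Summits.CriticalPhenomena.CardyFormulaZ2.Theses.CardySelfRefinement
import Summits.CriticalPhenomena.CardyFormulaZ2.Theorems.CardySelfRefinementLagHandOffRotationData
import HarnessLib

/-!
# The axis reflection of `ℤ²` on corners, the turning rule and discrete Dobrushin data
(helper for stub `stub_reflectionCovariant`, line `SketchIdeatorTwo`, crux `SymmetryUpgradeR`,
stmt-CriticalPhenomena-17239; registered helper stub `stub_reflectionCovariant_lattice`)

Lattice groundwork for the ACHIRALITY of the bond-`ℤ²` interface scaling limit (Werner 2007 §3.2,
condition (3)): the reflection `cellReflect : (x₀, x₁) ↦ (x₀, -x₁)` of `ℤ²` — the tree's cell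
symmetry `CellSymmetry.reflect` (`CellGridSaddleSymmetry.lean`: plane action `z ↦ z̄`, face action
`f ↦ cellReflect f - e₁`) — is an EXACT symmetry of G02's rendering of bond percolation with
Dobrushin boundary conditions (`MedialInterface.lean`), up to REVERSAL OF ORIENTATION.  After the
template of the quarter-turn dictionary `…LagHandOffRotationCorners/…RotationData`:

* the reflection is additive and REVERSES the cyclic order of the unit vectors
  (`cellReflect_cornerUnit : cellReflect (cornerUnit k) = cornerUnit (-k)`), so it carries the face
  `faceAt v k` to `faceAt (cellReflect v) (3 - k)` (`faceAt_cellReflect`), corners to corners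
  (`isCorner_reflect_iff`), and EXCHANGES `cornerSource` and `cornerTarget` (`cornerSource_reflect`,
  `cornerTarget_reflect`: an orientation-reversing symmetry turns "primal vertex on the left" into
  "on the right");
* hence the turning rule holds for the reflected configuration along the REVERSED reflected
  triple (`isMedialTurn_reflect_iff`), and medial steps are reversed (`isMedialStep_reflect_iff`);
* for data `E`, `E'` REFLECTED INTO EACH OTHER (`E'.Ω = conj E.Ω`, `E'.δ = E.δ`,
  `E'.arcA = conj E.arcA`, `E'.arcB = conj E.arcB`; no new definition, every statement carries the
  four equations) the graph `Ω_δ`, inner faces, face-boundary edges, `zdBoundary`, the discrete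
  arcs, the `A`–`B` edges and the completed configuration `bcBondConfig` of `E'` are the reflected
  ones of `E` (`adj_reflect_iff`, …, `bcBondConfig_reflect`), and admissibility is transported
  (the registered helper stub `stub_reflectionCovariant_lattice`).

References: W. Werner, *Lectures on two-dimensional critical percolation* (2007), §3.2;
S. Smirnov, C. R. Acad. Sci. Paris 333 (2001), §2; G. Grimmett, *Percolation* (1999), §1.6, §11.2.
-/

noncomputable section

namespace Summit.CriticalPhenomena.CardyFormulaZ2.Theorems.SymmetryUpgradeR.SwallowingSkeleton

open MeasureTheory Filter Set
open Literature.Probability.RandomPlanarGeometry Literature.Probability.LatticeModels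
  Literature.Probability.Percolation
open UpperHalfPlane (upperHalfPlaneSet)

/-! ### The axis reflection on sites, unit vectors and faces -/

/-- The axis reflection is additive. -/
theorem cellReflect_add (x y : Site 2) : cellReflect (x + y) = cellReflect x + cellReflect y := by
  rw [Site.eq_iff_two]
  constructor <;> simp only [cellReflect_apply_zero, cellReflect_apply_one, Pi.add_apply]
  omega

/-- **The reflection reverses the cyclic order of the unit vectors**:
`cellReflect (cornerUnit k) = cornerUnit (-k)` (east ↦ east, north ↦ south). -/
theorem cellReflect_cornerUnit (k : Fin 4) : cellReflect (cornerUnit k) = cornerUnit (-k) := by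
  fin_cases k <;> decide

/-- `Fin 4` arithmetic: `-(k + 1) = 3 - k`. -/
theorem fin4_neg_add_one (k : Fin 4) : -(k + 1) = 3 - k := by revert k; decide

/-- `Fin 4` arithmetic: `-k = 3 - k + 1`. -/
theorem fin4_neg_eq (k : Fin 4) : -k = 3 - k + 1 := by revert k; decide

/-- The face action of the reflection (`CellSymmetry.reflect.face`): `f ↦ cellReflect f - e₁`. -/
theorem reflect_face_apply (f : Site 2) :
    CellSymmetry.reflect.face f = cellReflect f + -(Pi.single 1 1 : Site 2) := rfl

/-- **The reflection on the faces around a vertex**: the `k`-th face at `v` is carried onto the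
`(3 - k)`-th face at `cellReflect v` (the cyclic order around the vertex is reversed). -/
theorem faceAt_cellReflect (v : Site 2) (k : Fin 4) :
    faceAt (cellReflect v) (3 - k) = CellSymmetry.reflect.face (faceAt v k) := by
  rw [reflect_face_apply, faceAt, faceAt, Site.eq_iff_two]
  fin_cases k <;>
    simp [cornerOff, cellReflect_apply_zero, cellReflect_apply_one] <;> omega

/-- Being a corner of a face is invariant under the reflection. -/
theorem isCorner_reflect_iff (v f : Site 2) :
    IsCorner (cellReflect v) (CellSymmetry.reflect.face f) ↔ IsCorner v f := by
  unfold Literature.Probability.LatticeModels.IsCorner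
  simp only [Fin.forall_fin_two, reflect_face_apply, cellReflect_apply_zero, cellReflect_apply_one,
    Pi.add_apply, Pi.neg_apply, single_one_apply_zero, single_one_apply_one]
  omega

/-- **`cornerSource` and `cornerTarget` are EXCHANGED by the reflection** (which reverses the
orientation of the plane, hence the counter-clockwise order of the two edges of a face at a
corner): the source edge of the reflected corner is the reflected target edge. -/
theorem cornerSource_reflect {v f : Site 2} (h : IsCorner v f) :
    cornerSource (cellReflect v) (CellSymmetry.reflect.face f) =
      sym2Equiv cellReflect (cornerTarget v f) := by
  obtain ⟨k, rfl⟩ := exists_faceAt_of_isCorner h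
  rw [← faceAt_cellReflect, cornerSource_faceAt, cornerTarget_faceAt, sym2Equiv_mk, cellReflect_add,
    cellReflect_cornerUnit, fin4_neg_add_one]

/-- The target edge of the reflected corner is the reflected source edge. -/
theorem cornerTarget_reflect {v f : Site 2} (h : IsCorner v f) :
    cornerTarget (cellReflect v) (CellSymmetry.reflect.face f) =
      sym2Equiv cellReflect (cornerSource v f) := by
  obtain ⟨k, rfl⟩ := exists_faceAt_of_isCorner h
  rw [← faceAt_cellReflect, cornerSource_faceAt, cornerTarget_faceAt, sym2Equiv_mk, cellReflect_add,
    cellReflect_cornerUnit, fin4_neg_eq]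

/-! ### Lattice edges and configurations -/

/-- The reflection preserves the edges of `ℤ²` (it is an automorphism of `ℤ²`). -/
theorem reflect_mem_edgeSet_iff (e : Sym2 (Site 2)) :
    sym2Equiv cellReflect e ∈ (zdGraph 2).edgeSet ↔ e ∈ (zdGraph 2).edgeSet :=
  sym2Equiv_mem_edgeSet_iff (G := zdGraph 2) (G' := zdGraph 2)
    { toEquiv := cellReflect, map_rel_iff' := fun {a b} => CellSymmetry.reflect.zdGraph_adj_cell a b } e

/-- `∀` over the reflected pair. -/
theorem forall_mem_reflect_iff (e : Sym2 (Site 2)) (P : Site 2 → Prop) :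
    (∀ x ∈ sym2Equiv cellReflect e, P x) ↔ ∀ x ∈ e, P (cellReflect x) := by
  simp [Sym2.mem_map]

/-- `∃` over the reflected pair. -/
theorem exists_mem_reflect_iff (e : Sym2 (Site 2)) (P : Site 2 → Prop) :
    (∃ x ∈ sym2Equiv cellReflect e, P x) ↔ ∃ x ∈ e, P (cellReflect x) := by
  simp [Sym2.mem_map]

/-! ### The turning rule is reversed -/

/-- **The turning rule under the reflection.** Reflecting the configuration and the three medial
vertices and REVERSING their order preserves the turning rule: an orientation-reversing symmetry
exchanges left and right, and so does time reversal (open edges stay on the left of the reversed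
reflected path, dual-open ones on its right). -/
theorem isMedialTurn_reflect_iff (ω : BondConfig (Site 2)) (e₀ e₁ e₂ : MedialVertex) :
    IsMedialTurn (BondConfig.relabel (sym2Equiv cellReflect) ω) (sym2Equiv cellReflect e₂)
      (sym2Equiv cellReflect e₁) (sym2Equiv cellReflect e₀) ↔ IsMedialTurn ω e₀ e₁ e₂ := by
  -- adapted from `isMedialTurn_rot_iff` of `…LagHandOffRotationCorners`
  have tgt_mem : ∀ {v f : Site 2}, IsCorner v f → cornerTarget v f ∈ (zdGraph 2).edgeSet := by
    intro v f hv
    obtain ⟨k, rfl⟩ := exists_faceAt_of_isCorner hv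
    rw [cornerTarget_faceAt]
    exact cSrc_mem_edgeSet (v, k + 1)
  have test : ∀ (ω' : BondConfig (Site 2)) {e : Sym2 (Site 2)}, e ∈ (zdGraph 2).edgeSet →
      (dualEdge e ∈ dualConfig ω' ↔ e ∉ ω') := by
    intro ω' e he
    rw [mem_dualConfig_iff]
    constructor
    · rintro ⟨-, h⟩ heω
      exact h e heω rfl
    · intro h
      exact ⟨dualEdge_mem_edgeSet_holds he, fun e' he' heq => h (dualEdge_bijective.1 heq ▸ he')⟩
  have key : ∀ {e : Sym2 (Site 2)}, e ∈ (zdGraph 2).edgeSet →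
      (dualEdge (sym2Equiv cellReflect e) ∈ dualConfig (BondConfig.relabel (sym2Equiv cellReflect) ω) ↔
        dualEdge e ∈ dualConfig ω) := by
    intro e he
    rw [test _ ((reflect_mem_edgeSet_iff e).2 he), test _ he, BondConfig.mem_relabel_iff,
      Equiv.symm_apply_apply]
  have inj := (sym2Equiv cellReflect).injective
  constructor
  · rintro ⟨v₁', f₁', v₂', f₂', hc₁, hs₁, ht₁, hc₂, hs₂, ht₂, hlast⟩
    obtain ⟨w₁, rfl⟩ := cellReflect.surjective v₁'
    obtain ⟨g₁, rfl⟩ := CellSymmetry.reflect.face.surjective f₁'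
    obtain ⟨w₂, rfl⟩ := cellReflect.surjective v₂'
    obtain ⟨g₂, rfl⟩ := CellSymmetry.reflect.face.surjective f₂'
    rw [isCorner_reflect_iff] at hc₁ hc₂
    rw [cornerSource_reflect hc₁] at hs₁
    rw [cornerSource_reflect hc₂] at hs₂
    rw [cornerTarget_reflect hc₁] at ht₁
    rw [cornerTarget_reflect hc₂] at ht₂
    -- `(w₁, g₁)` carries the dart `(e₁, e₂)`, `(w₂, g₂)` carries `(e₀, e₁)`
    have he₁ : e₁ ∈ (zdGraph 2).edgeSet := by
      rw [← inj hs₂]; exact tgt_mem hc₂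
    rw [cellReflect.injective.eq_iff, CellSymmetry.reflect.face.injective.eq_iff, key he₁,
      BondConfig.mem_relabel_iff, Equiv.symm_apply_apply] at hlast
    refine ⟨w₂, g₂, w₁, g₁, hc₂, inj ht₂, inj hs₂, hc₁, inj ht₁, inj hs₁, ?_⟩
    rcases hlast with ⟨hv, hd⟩ | ⟨hf, ho⟩
    · exact Or.inl ⟨hv.symm, hd⟩
    · exact Or.inr ⟨hf.symm, ho⟩
  · rintro ⟨v₁, f₁, v₂, f₂, hc₁, rfl, rfl, hc₂, hs₂, rfl, hlast⟩
    refine ⟨cellReflect v₂, CellSymmetry.reflect.face f₂, cellReflect v₁, CellSymmetry.reflect.face f₁,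
      (isCorner_reflect_iff _ _).2 hc₂, cornerSource_reflect hc₂, by rw [cornerTarget_reflect hc₂, hs₂],
      (isCorner_reflect_iff _ _).2 hc₁, cornerSource_reflect hc₁, cornerTarget_reflect hc₁, ?_⟩
    rw [cellReflect.injective.eq_iff, CellSymmetry.reflect.face.injective.eq_iff,
      key (tgt_mem hc₁), BondConfig.mem_relabel_iff, Equiv.symm_apply_apply]
    rcases hlast with ⟨hv, hd⟩ | ⟨hf, ho⟩
    · exact Or.inl ⟨hv.symm, hd⟩
    · exact Or.inr ⟨hf.symm, ho⟩

/-! ### The tree's transport lemmas, read for `cellReflect` -/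

/-- The plane action of the reflection on sets is complex conjugation. -/
theorem image_conj_eq_reflect_plane (S : Set ℂ) :
    (starRingEnd ℂ) '' S = CellSymmetry.reflect.plane '' S :=
  (CellSymmetry.image_reflect_plane S).symm

/-- Mesh points are transported by the reflection (plane-action form). -/
theorem meshPoint_cellReflect_plane (δ : ℝ) (x : Site 2) :
    meshPoint δ (cellReflect x) = CellSymmetry.reflect.plane (meshPoint δ x) :=
  CellSymmetry.reflect.meshPoint_cell δ x

/-- Lattice adjacency is invariant under the reflection. -/
theorem zdGraph_adj_cellReflect_iff (x y : Site 2) :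
    (zdGraph 2).Adj (cellReflect x) (cellReflect y) ↔ (zdGraph 2).Adj x y :=
  CellSymmetry.reflect.zdGraph_adj_cell x y

/-! ### Reflected Dobrushin data -/

section Data

variable {E E' : DiscreteDobrushin}
  (hΩ : E'.Ω = (starRingEnd ℂ) '' E.Ω) (hδ : E'.δ = E.δ)
  (hA : E'.arcA = (starRingEnd ℂ) '' E.arcA)
  (hB : E'.arcB = (starRingEnd ℂ) '' E.arcB)

include hΩ hδ

/-- The graph `Ω_δ` of the reflected data is the reflected graph. -/
theorem adj_reflect_iff (x y : Site 2) :
    (discreteDomainGraph E'.Ω E'.δ).Adj (cellReflect x) (cellReflect y) ↔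
      (discreteDomainGraph E.Ω E.δ).Adj x y := by
  rw [hΩ, hδ, image_conj_eq_reflect_plane]
  exact CellSymmetry.reflect.discreteDomainGraph_adj_cell

/-- The edges of `Ω_δ` of the reflected data are the reflected edges. -/
theorem reflect_mem_edgeSet_data_iff (e : Sym2 (Site 2)) :
    sym2Equiv cellReflect e ∈ (discreteDomainGraph E'.Ω E'.δ).edgeSet ↔
      e ∈ (discreteDomainGraph E.Ω E.δ).edgeSet := by
  induction e using Sym2.ind with
  | h x y => rw [sym2Equiv_mk, SimpleGraph.mem_edgeSet, SimpleGraph.mem_edgeSet, adj_reflect_iff hΩ hδ]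

/-- Inner faces of the reflected data are the reflected inner faces. -/
theorem isInnerFace_reflect_iff (f : Site 2) :
    E'.IsInnerFace (CellSymmetry.reflect.face f) ↔ E.IsInnerFace f := by
  -- adapted from `isInnerFace_rot_iff` of `…LagHandOffRotationData`
  constructor
  · intro h v v' hv hv' hadj
    rw [← adj_reflect_iff hΩ hδ]
    exact h _ _ ((isCorner_reflect_iff v f).2 hv) ((isCorner_reflect_iff v' f).2 hv')
      ((zdGraph_adj_cellReflect_iff v v').2 hadj)
  · intro h v₁ v₂ hv₁ hv₂ hadj
    obtain ⟨v, rfl⟩ := cellReflect.surjective v₁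
    obtain ⟨v', rfl⟩ := cellReflect.surjective v₂
    rw [adj_reflect_iff hΩ hδ]
    exact h _ _ ((isCorner_reflect_iff v f).1 hv₁) ((isCorner_reflect_iff v' f).1 hv₂)
      ((zdGraph_adj_cellReflect_iff v v').1 hadj)

/-- Face-boundary edges of the reflected data are the reflected ones. -/
theorem isFaceBoundaryEdge_reflect_iff (x y : Site 2) :
    E'.IsFaceBoundaryEdge (cellReflect x) (cellReflect y) ↔ E.IsFaceBoundaryEdge x y := by
  constructor
  · rintro ⟨hadj, ⟨f₁, hf, hx, hy⟩, g₁, hg, hx', hy'⟩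
    obtain ⟨f, rfl⟩ := CellSymmetry.reflect.face.surjective f₁
    obtain ⟨g, rfl⟩ := CellSymmetry.reflect.face.surjective g₁
    rw [isInnerFace_reflect_iff hΩ hδ] at hf hg
    rw [isCorner_reflect_iff] at hx hy hx' hy'
    exact ⟨(adj_reflect_iff hΩ hδ x y).1 hadj, ⟨f, hf, hx, hy⟩, g, hg, hx', hy'⟩
  · rintro ⟨hadj, ⟨f, hf, hx, hy⟩, g, hg, hx', hy'⟩
    exact ⟨(adj_reflect_iff hΩ hδ x y).2 hadj, ⟨CellSymmetry.reflect.face f,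
      (isInnerFace_reflect_iff hΩ hδ f).2 hf, (isCorner_reflect_iff x f).2 hx,
      (isCorner_reflect_iff y f).2 hy⟩, CellSymmetry.reflect.face g,
      fun h => hg ((isInnerFace_reflect_iff hΩ hδ g).1 h), (isCorner_reflect_iff x g).2 hx',
      (isCorner_reflect_iff y g).2 hy'⟩

/-- The square-lattice boundary of the reflected data is the reflected boundary. -/
theorem mem_zdBoundary_reflect_iff (x : Site 2) :
    cellReflect x ∈ E'.zdBoundary ↔ x ∈ E.zdBoundary := by
  rw [DiscreteDobrushin.mem_zdBoundary_iff, DiscreteDobrushin.mem_zdBoundary_iff]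
  refine or_congr ?_ ⟨?_, ?_⟩
  · rw [hΩ, hδ, image_conj_eq_reflect_plane]
    exact CellSymmetry.reflect.mem_meshBoundary_cell
  · rintro ⟨y₁, hy⟩
    obtain ⟨y, rfl⟩ := cellReflect.surjective y₁
    exact ⟨y, (isFaceBoundaryEdge_reflect_iff hΩ hδ x y).1 hy⟩
  · rintro ⟨y, hy⟩
    exact ⟨cellReflect y, (isFaceBoundaryEdge_reflect_iff hΩ hδ x y).2 hy⟩

/-- Discrete arcs of the reflected data (and reflected arc) are the reflected discrete arcs: the
metric comparison selecting them is invariant under the isometry `z ↦ z̄`. -/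
theorem mem_zdDiscreteArc_reflect_iff (A' : Set ℂ) (x : Site 2) :
    cellReflect x ∈ E'.zdDiscreteArc ((starRingEnd ℂ) '' A') ↔ x ∈ E.zdDiscreteArc A' := by
  rw [DiscreteDobrushin.mem_zdDiscreteArc_iff, DiscreteDobrushin.mem_zdDiscreteArc_iff,
    mem_zdBoundary_reflect_iff hΩ hδ, hδ, hΩ, image_conj_eq_reflect_plane,
    image_conj_eq_reflect_plane, meshPoint_cellReflect_plane,
    CellSymmetry.reflect.frontier_image_plane,
    ← Set.image_sdiff CellSymmetry.reflect.plane.injective,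
    Metric.infDist_image CellSymmetry.reflect.plane.isometry,
    Metric.infDist_image CellSymmetry.reflect.plane.isometry]

include hA in
/-- The discrete arc of `A` of the reflected data is the reflected one. -/
theorem mem_zdArcA_reflect_iff (x : Site 2) : cellReflect x ∈ E'.zdArcA ↔ x ∈ E.zdArcA := by
  rw [DiscreteDobrushin.zdArcA, DiscreteDobrushin.zdArcA, hA]
  exact mem_zdDiscreteArc_reflect_iff hΩ hδ E.arcA x

include hB in
/-- The discrete arc of `B` of the reflected data is the reflected one. -/
theorem mem_zdArcB_reflect_iff (x : Site 2) : cellReflect x ∈ E'.zdArcB ↔ x ∈ E.zdArcB := by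
  rw [DiscreteDobrushin.zdArcB, DiscreteDobrushin.zdArcB, hB]
  exact mem_zdDiscreteArc_reflect_iff hΩ hδ E.arcB x

include hA hB

/-- The `A`–`B` edges of the reflected data are the reflected `A`–`B` edges. -/
theorem reflect_mem_zdABEdges_iff (e : Sym2 (Site 2)) :
    sym2Equiv cellReflect e ∈ E'.zdABEdges ↔ e ∈ E.zdABEdges := by
  rw [DiscreteDobrushin.mem_zdABEdges_iff, DiscreteDobrushin.mem_zdABEdges_iff,
    reflect_mem_edgeSet_data_iff hΩ hδ, exists_mem_reflect_iff, exists_mem_reflect_iff]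
  simp only [mem_zdArcA_reflect_iff hΩ hδ hA, mem_zdArcB_reflect_iff hΩ hδ hB]

/-- The set of `A`–`B` edges of the reflected data is the image of that of the data. -/
theorem zdABEdges_reflect_eq : E'.zdABEdges = sym2Equiv cellReflect '' E.zdABEdges := by
  ext e₁
  obtain ⟨e, rfl⟩ := (sym2Equiv cellReflect).surjective e₁
  rw [reflect_mem_zdABEdges_iff hΩ hδ hA hB, (sym2Equiv cellReflect).injective.mem_set_image]

/-- Imposing the boundary conditions commutes with reflecting data and configuration. -/
theorem bcBondConfig_reflect (ω : BondConfig (Site 2)) :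
    E'.bcBondConfig (BondConfig.relabel (sym2Equiv cellReflect) ω) =
      BondConfig.relabel (sym2Equiv cellReflect) (E.bcBondConfig ω) := by
  ext e₁
  obtain ⟨e, rfl⟩ := (sym2Equiv cellReflect).surjective e₁
  rw [BondConfig.mem_relabel_iff, Equiv.symm_apply_apply, DiscreteDobrushin.mem_bcBondConfig_iff,
    DiscreteDobrushin.mem_bcBondConfig_iff, reflect_mem_edgeSet_data_iff hΩ hδ,
    BondConfig.mem_relabel_iff, Equiv.symm_apply_apply, forall_mem_reflect_iff,
    forall_mem_reflect_iff]
  simp only [mem_zdArcA_reflect_iff hΩ hδ hA, mem_zdArcB_reflect_iff hΩ hδ hB]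

omit hA hB in
/-- **Medial steps are reversed**: `(σ e', σ e)` is a medial step of the reflected data iff
`(e, e')` is a medial step of the data (the reflected corner has source and target exchanged). -/
theorem isMedialStep_reflect_iff (e e' : MedialVertex) :
    E'.IsMedialStep (sym2Equiv cellReflect e') (sym2Equiv cellReflect e) ↔ E.IsMedialStep e e' := by
  constructor
  · rintro ⟨v₁, f₁, hc, hf, hs, ht⟩
    obtain ⟨v, rfl⟩ := cellReflect.surjective v₁
    obtain ⟨f, rfl⟩ := CellSymmetry.reflect.face.surjective f₁
    rw [isCorner_reflect_iff] at hc
    rw [cornerSource_reflect hc] at hs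
    rw [cornerTarget_reflect hc] at ht
    exact ⟨v, f, hc, (isInnerFace_reflect_iff hΩ hδ f).1 hf, (sym2Equiv _).injective ht,
      (sym2Equiv _).injective hs⟩
  · rintro ⟨v, f, hc, hf, rfl, rfl⟩
    exact ⟨cellReflect v, CellSymmetry.reflect.face f, (isCorner_reflect_iff v f).2 hc,
      (isInnerFace_reflect_iff hΩ hδ f).2 hf, cornerSource_reflect hc, cornerTarget_reflect hc⟩

end Data

/-- **Registered helper stub `stub_reflectionCovariant_lattice` — admissibility is transported**:
the conjugate data of admissible square-lattice Dobrushin data are admissible (bounded conjugate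
domain, same mesh, reflected nonempty disjoint arcs covering the reflected boundary, the two
reflected `A`–`B` edges each bordering exactly one reflected inner face). -/
theorem stub_reflectionCovariant_lattice : ∀ (E E' : DiscreteDobrushin), E'.Ω = (starRingEnd ℂ) '' E.Ω → E'.δ = E.δ → E'.arcA = (starRingEnd ℂ) '' E.arcA → E'.arcB = (starRingEnd ℂ) '' E.arcB → E.IsZdAdmissible → E'.IsZdAdmissible :=
  fun E E' hΩ hδ hA hB h =>
  { isBounded := by
      rw [hΩ, image_conj_eq_reflect_plane]
      exact CellSymmetry.reflect.plane.lipschitz.isBounded_image h.isBounded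
    delta_pos := by rw [hδ]; exact h.delta_pos
    zdArcA_nonempty := by
      obtain ⟨x, hx⟩ := h.zdArcA_nonempty
      exact ⟨cellReflect x, (mem_zdArcA_reflect_iff hΩ hδ hA x).2 hx⟩
    zdArcB_nonempty := by
      obtain ⟨x, hx⟩ := h.zdArcB_nonempty
      exact ⟨cellReflect x, (mem_zdArcB_reflect_iff hΩ hδ hB x).2 hx⟩
    disjoint := by
      rw [Set.disjoint_left]
      intro y₁ hyA hyB
      obtain ⟨y, rfl⟩ := cellReflect.surjective y₁
      exact Set.disjoint_left.1 h.disjoint ((mem_zdArcA_reflect_iff hΩ hδ hA y).1 hyA)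
        ((mem_zdArcB_reflect_iff hΩ hδ hB y).1 hyB)
    zdBoundary_subset := by
      intro y₁ hy
      obtain ⟨y, rfl⟩ := cellReflect.surjective y₁
      rcases h.zdBoundary_subset ((mem_zdBoundary_reflect_iff hΩ hδ y).1 hy) with hy' | hy'
      · exact Or.inl ((mem_zdArcA_reflect_iff hΩ hδ hA y).2 hy')
      · exact Or.inr ((mem_zdArcB_reflect_iff hΩ hδ hB y).2 hy')
    ncard_zdABEdges_eq_two := by
      rw [zdABEdges_reflect_eq hΩ hδ hA hB,
        Set.ncard_image_of_injective _ (sym2Equiv cellReflect).injective, h.ncard_zdABEdges_eq_two]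
    zdABEdges_inner := by
      intro e₁ he₁
      obtain ⟨e, rfl⟩ := (sym2Equiv cellReflect).surjective e₁
      have he := (reflect_mem_zdABEdges_iff hΩ hδ hA hB e).1 he₁
      obtain ⟨f, ⟨hf, hcf⟩, huniq⟩ := h.zdABEdges_inner e he
      refine ⟨CellSymmetry.reflect.face f, ⟨(isInnerFace_reflect_iff hΩ hδ f).2 hf, ?_⟩, ?_⟩
      · rw [forall_mem_reflect_iff]
        exact fun x hx => (isCorner_reflect_iff x f).2 (hcf x hx)
      · intro g₁ ⟨hg, hcg⟩
        obtain ⟨g, rfl⟩ := CellSymmetry.reflect.face.surjective g₁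
        rw [forall_mem_reflect_iff] at hcg
        rw [huniq g ⟨(isInnerFace_reflect_iff hΩ hδ g).1 hg,
          fun x hx => (isCorner_reflect_iff x g).1 (hcg x hx)⟩] }

end Summit.CriticalPhenomena.CardyFormulaZ2.Theorems.SymmetryUpgradeR.SwallowingSkeleton

end
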